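import Mathlib
import Literature.NumberTheory.LFunctions.Zhang2022.TypedSection04C
import Literature.NumberTheory.LFunctions.Zhang2022.Section4Eq410Edge
import Literature.NumberTheory.LFunctions.Zhang2022.Section4Lemma43Edge
import Literature.NumberTheory.LFunctions.Zhang2022.Section2Lemma23Inputs
import HarnessLib

/-!
# Zhang (2022), §4 p. 22, proof of Lemma 4.6 — the Rouché step "`𝒜(1/2+iγ+w,ψ)` has exactly one
# zero inside `|w| = α(1−c′α𝓛)`, counted with multiplicity", kernel-checked MODULO the
# exact-count form of Rouché's theorem (FACT F-29, hypothesis form)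

Topic `Literature/NumberTheory/LFunctions/Zhang2022` (Landau–Siegel audit tree; verdict-neutral).
Y. Zhang, *Discrete mean estimates and the Landau–Siegel zero*, arXiv:2211.02515v1 (2022)
[Zhang2022LandauSiegel] — **an unrefereed manuscript under adjudication**; the nodes below are the
campaign's CLAIM nodes (`SkeletonPartOne`, `TypedSection04C`), stated not asserted. DAG node
`Z22:Lem4.6.pf` [Z22 p.22, tex L1210–L1215]:

> Proof. It suffices to show that the function `𝒜(1/2+iγ+w,ψ)` has exactly one zero inside the
> circle `|w| = α(1−c′α𝓛)`, counted with multiplicity. By the Rouché theorem, this can be reduced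
> to proving that `|𝒜(1/2+iγ+w,ψ) − (1−P^{−2w})| < |1−P^{−2w}|` for `|w| = α(1−c′α𝓛)`, since the
> function `1 − P^{−2w}` has exactly one zero inside this circle which is at `w = 0`.

This file proves the edge

  `lem46OneZero_of_rouche : RouchéCount → Lemma42 → 0 ≤ c′ → Step4u048 c′ → Lem46OneZero c′`

where `Step4u048 c′` is the typed Rouché hypothesis (the displayed inequality on the circle, node
`Z22:§4.u048`), `Lem46OneZero c′` is the typed target "exactly one zero, and it is simple"
(`TypedSection04C`), and **`RouchéCount` is FACT F-29 of the campaign's frozen FACT-LIST in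
HYPOTHESIS FORM** (Conway, *Functions of One Complex Variable* V §3 Thm 3.8; Ahlfors Ch. 4 §5.2):
for `f, g` holomorphic on a neighbourhood of a closed disc with `|f − g| < |g|` on its boundary,
`f` and `g` have the same number of zeros inside, counted with multiplicity — multiplicity being
Mathlib's `analyticOrderNatAt`, the count `∑ᶠ z ∈ ball c r, analyticOrderNatAt f z`. No Lean
declaration of Rouché's theorem in this form exists in Mathlib or the tree today (FACT-LIST row
F-29, class H); the binder below is exactly the statement such a theorem would have, so the edge
becomes unconditional the moment it is proved (`Literature/Analysis/Complex/`, campaign task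
P-ext-1). Composing with `TypedSection04C.DedLem46` (the Rouché-free reflection half, slice L1-t7)
gives Lemma 4.6 itself modulo F-29: `lemma46_of_rouche : RouchéCount → Lemma42 → Eq412 →
∃ c₀, ∀ c′ > c₀, Lemma46 c′` (with `step4u048_of_eq412`, `dedLem46_holds`, `llZeroReflect_holds`).

Kernel content, besides bookkeeping:
* `finsum_analyticOrderNatAt_eq_one_of_zeros_eq` — a function analytic on a ball whose zero set
  there is `{0}`, with `g′(0) ≠ 0`, has zero-count `1`;
* `existsUnique_zero_of_finsum_analyticOrderNatAt_eq_one` — conversely, an analytic function on a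
  ball with zero-count `1` has exactly one zero there, and it is simple (identity principle on the
  connected ball: no point of infinite order; `analyticOrderAt = 1 ⇒ f′ ≠ 0`);
* `differentiableOn_calA_shift` — "`𝒜(s,ψ)` is analytic … in `Ω₁`" (§4 p. 21): for `D` large and
  `ψ ∈ Ψ₁`, `w ↦ 𝒜(1/2+iγ+w,ψ) = L·L/F` is holomorphic on `|w| < 2α` (`F ≠ 0` there by Lemma 4.2,
  `|FG − 1| ≤ 1/2`; `L(s,ψ)L(s,ψχ)` entire, `Skeleton.differentiable_LL` of `Section2Lemma23Inputs`).

What is NOT asserted: Rouché's theorem; Lemma 4.2; (4.12)/`Z22:§4.u048`; hence not Lemma 4.6 as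
such. Nothing about Theorems 1–2 of the source is stated or implied, nor about the verdict on (8.24).

## References

* Y. Zhang, arXiv:2211.02515v1 (2022), §4 p. 22, Lemma 4.6 and its proof; (4.12), (4.13).
  [cite: Zhang2022LandauSiegel, §4 Lemma 4.6 (proof)]
* J. B. Conway, *Functions of One Complex Variable* (1973), V §3 Thm 3.8 (Rouché) = FACT F-29.
-/

noncomputable section

open Complex Real Set Filter Topology

namespace Literature.NumberTheory.LFunctions.Zhang2022.Section4

open Literature.NumberTheory.LFunctions.Zhang2022.Skeleton

/-! ## Counting zeros with multiplicity: `∑ᶠ z ∈ ball, analyticOrderNatAt f z` -/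

/-- **"has exactly one zero inside this circle which is at `w = 0`", as a count**: if `g` is analytic
on the ball `|w| < r`, its zeros there are exactly `{0}`, and `g′(0) ≠ 0`, then the number of zeros of
`g` in the ball counted with multiplicity is `1`. [cite: Zhang2022LandauSiegel, §4 Lemma 4.6 (proof)] -/
theorem finsum_analyticOrderNatAt_eq_one_of_zeros_eq {g : ℂ → ℂ} {r : ℝ}
    (hg : AnalyticOnNhd ℂ g (Metric.ball 0 r))
    (hzero : {w : ℂ | ‖w‖ < r ∧ g w = 0} = {0}) (hder : deriv g 0 ≠ 0) :
    ∑ᶠ w ∈ Metric.ball (0 : ℂ) r, analyticOrderNatAt g w = 1 := by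
  have h0 : (0 : ℂ) ∈ {w : ℂ | ‖w‖ < r ∧ g w = 0} := by rw [hzero]; exact Set.mem_singleton 0
  obtain ⟨h0r, hg0⟩ := h0
  have h0ball : (0 : ℂ) ∈ Metric.ball (0 : ℂ) r := by rwa [mem_ball_zero_iff]
  have hord0 : analyticOrderAt g 0 = 1 :=
    (hg 0 h0ball).analyticOrderAt_eq_one_of_zero_deriv_ne_zero hg0 hder
  have hnat0 : analyticOrderNatAt g 0 = 1 := by
    simp [analyticOrderNatAt, hord0]
  rw [finsum_mem_def]
  rw [finsum_eq_single _ 0 fun w hw => ?_]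
  · rw [Set.indicator_of_mem h0ball, hnat0]
  · by_cases hwb : w ∈ Metric.ball (0 : ℂ) r
    · rw [Set.indicator_of_mem hwb]
      have hgw : g w ≠ 0 := by
        intro hgw
        have : w ∈ {w : ℂ | ‖w‖ < r ∧ g w = 0} := ⟨mem_ball_zero_iff.mp hwb, hgw⟩
        rw [hzero] at this
        exact hw this
      have : analyticOrderAt g w = 0 := (hg w hwb).analyticOrderAt_eq_zero.mpr hgw
      simp [analyticOrderNatAt, this]
    · rw [Set.indicator_of_notMem hwb]

/-- **"exactly one zero … counted with multiplicity" implies "one zero, and it is simple"**: if `f` is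
analytic on the ball `|w| < r` and the number of its zeros there counted with multiplicity
(`∑ᶠ analyticOrderNatAt`) is `1`, then the zero set of `f` in the ball is a singleton `{w₀}` and
`f′(w₀) ≠ 0`. (Identity principle on the connected ball: a count of `1` forces a point of finite
order, hence no point of infinite order, so `analyticOrderNatAt` vanishes exactly off the zeros.)
[cite: Zhang2022LandauSiegel, §4 Lemma 4.6 (proof)] -/
theorem existsUnique_zero_of_finsum_analyticOrderNatAt_eq_one {f : ℂ → ℂ} {r : ℝ}
    (hf : AnalyticOnNhd ℂ f (Metric.ball 0 r))
    (hsum : ∑ᶠ w ∈ Metric.ball (0 : ℂ) r, analyticOrderNatAt f w = 1) :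
    ∃ w₀ : ℂ, {w : ℂ | ‖w‖ < r ∧ f w = 0} = {w₀} ∧ deriv f w₀ ≠ 0 := by
  classical
  -- the support inside the ball is finite (else the count is the junk value `0`)
  have hfin : (Metric.ball (0 : ℂ) r ∩ Function.support (analyticOrderNatAt f)).Finite := by
    by_contra hinf
    rw [finsum_mem_eq_zero_of_infinite hinf] at hsum
    exact zero_ne_one hsum
  rw [finsum_mem_eq_sum (analyticOrderNatAt f) hfin] at hsum
  set T := hfin.toFinset with hT
  have memT : ∀ w, w ∈ T ↔ w ∈ Metric.ball (0 : ℂ) r ∧ analyticOrderNatAt f w ≠ 0 := fun w => by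
    rw [hT, Set.Finite.mem_toFinset, Set.mem_inter_iff, Function.mem_support]
  -- a count of `1` is carried by a single point `w₀` with `analyticOrderNatAt f w₀ = 1`
  have hTne : T.Nonempty := by
    by_contra hT0
    rw [Finset.not_nonempty_iff_eq_empty] at hT0
    rw [hT0, Finset.sum_empty] at hsum
    exact zero_ne_one hsum
  obtain ⟨w₀, hw₀T⟩ := hTne
  obtain ⟨hw₀ball, hw₀ne⟩ := (memT w₀).mp hw₀T
  have hsplit := Finset.add_sum_erase T (analyticOrderNatAt f) hw₀T
  rw [hsum] at hsplit
  have hw₀1 : analyticOrderNatAt f w₀ = 1 := by omega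
  have hrest : ∑ w ∈ T.erase w₀, analyticOrderNatAt f w = 0 := by omega
  have hTsub : ∀ w ∈ T, w = w₀ := by
    intro w hw
    by_contra hne
    have hmem : w ∈ T.erase w₀ := Finset.mem_erase.mpr ⟨hne, hw⟩
    exact ((memT w).mp hw).2 (Finset.sum_eq_zero_iff.mp hrest w hmem)
  -- `w₀` has order exactly `1`; hence no point of the (connected) ball has infinite order
  have hne_top : analyticOrderAt f w₀ ≠ ⊤ := by
    intro htop
    have : analyticOrderNatAt f w₀ = 0 := by simp [analyticOrderNatAt, htop]
    omega
  have hord1 : analyticOrderAt f w₀ = 1 := by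
    rw [← Nat.cast_analyticOrderNatAt hne_top, hw₀1, Nat.cast_one]
  have hnotop : ∀ w ∈ Metric.ball (0 : ℂ) r, analyticOrderAt f w ≠ ⊤ := fun w hw =>
    hf.analyticOrderAt_ne_top_of_isPreconnected (convex_ball 0 r).isPreconnected hw₀ball hw hne_top
  -- on the ball: `f w = 0 ↔ analyticOrderNatAt f w ≠ 0`
  have hzero_iff : ∀ w ∈ Metric.ball (0 : ℂ) r, f w = 0 ↔ analyticOrderNatAt f w ≠ 0 := by
    intro w hw
    have h1 : analyticOrderAt f w = 0 ↔ f w ≠ 0 := (hf w hw).analyticOrderAt_eq_zero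
    have h2 : analyticOrderNatAt f w = 0 ↔ analyticOrderAt f w = 0 := by
      rw [analyticOrderNatAt, ENat.toNat_eq_zero]
      exact ⟨fun h' => h'.resolve_right (hnotop w hw), fun h' => Or.inl h'⟩
    rw [Ne, h2, h1, not_not]
  refine ⟨w₀, ?_, ?_⟩
  · ext w
    simp only [Set.mem_setOf_eq, Set.mem_singleton_iff]
    constructor
    · rintro ⟨hwr, hfw⟩
      have hwb : w ∈ Metric.ball (0 : ℂ) r := mem_ball_zero_iff.mpr hwr
      exact hTsub w ((memT w).mpr ⟨hwb, (hzero_iff w hwb).mp hfw⟩)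
    · rintro rfl
      exact ⟨mem_ball_zero_iff.mp hw₀ball, (hzero_iff _ hw₀ball).mpr hw₀ne⟩
  · -- `analyticOrderAt f w₀ = 1 < 2`, so not both `f(w₀) = 0` and `f′(w₀) = 0`
    have hfw₀ : f w₀ = 0 := (hzero_iff w₀ hw₀ball).mpr hw₀ne
    have h2 : ¬ ((2 : ℕ) : ℕ∞) ≤ analyticOrderAt f w₀ := by
      rw [hord1]; exact_mod_cast (by norm_num : ¬ (2 ≤ 1))
    rw [natCast_le_analyticOrderAt_iff_iteratedDeriv_eq_zero (hf w₀ hw₀ball)] at h2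
    push Not at h2
    obtain ⟨i, hi, hne⟩ := h2
    interval_cases i
    · rw [iteratedDeriv_zero] at hne
      exact (hne hfw₀).elim
    · rwa [iteratedDeriv_one] at hne

/-! ## Analyticity of `w ↦ 𝒜(1/2+iγ+w,ψ)` on `|w| < 2α` (from Lemma 4.2) -/

variable {D : ℕ} [NeZero D] (χ : DirichletCharacter ℂ D)

omit [NeZero D] in
/-- `2α ≤ log𝓛/(100𝓛)` once `𝓛 ≥ 3` (`α = π𝓛⁻⁹`; `200π𝓛 ≤ 𝓛⁹ ≤ 𝓛⁹log𝓛`): the disc `|w| < 2α`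
around a point of the critical line stays inside the `σ`-range of `Ω₁`.
[cite: Zhang2022LandauSiegel, §2 (2.10)] -/
theorem two_mul_alpha_le_of_three_le_ell (hℓ : 3 ≤ ell D) :
    2 * alpha D ≤ Real.log (ell D) / (100 * ell D) := by
  have hℓ0 : 0 < ell D := by linarith
  have hlog : 1 ≤ Real.log (ell D) := by
    have h3 : (1 : ℝ) < Real.log 3 := by
      rw [Real.lt_log_iff_exp_lt (by norm_num)]
      exact Real.exp_one_lt_d9.trans (by norm_num)
    exact le_trans h3.le (Real.log_le_log (by norm_num) hℓ)
  have hπ : π < 4 := Real.pi_lt_four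
  rw [alpha, bigP, Real.log_exp, mul_div_assoc', div_le_div_iff₀ (pow_pos hℓ0 9) (by positivity)]
  have h8 : (6561 : ℝ) ≤ ell D ^ 8 := by
    calc (6561 : ℝ) = 3 ^ 8 := by norm_num
      _ ≤ ell D ^ 8 := by gcongr
  calc 2 * π * (100 * ell D) ≤ 2 * 4 * (100 * ell D) := by gcongr
    _ ≤ 6561 * ell D := by linarith
    _ ≤ ell D ^ 8 * ell D := by gcongr
    _ = 1 * ell D ^ 9 := by ring
    _ ≤ Real.log (ell D) * ell D ^ 9 := by gcongr

omit [NeZero D] in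
/-- `log𝓛/(100𝓛) ≤ 1/100 < 3` (`log x ≤ x`). [folklore] -/
private theorem log_div_le (hℓ : 3 ≤ ell D) : Real.log (ell D) / (100 * ell D) ≤ 1 / 100 := by
  have hℓ0 : 0 < ell D := by linarith
  rw [div_le_div_iff₀ (by positivity) (by norm_num), one_mul]
  linarith [Real.log_le_sub_one_of_pos hℓ0]

omit [NeZero D] in
/-- For `ρ` in the height window `|γ − 2πt₀| < 𝓛₁ + 2` and `|w| < 2α` (`𝓛 ≥ 3`), the point
`1/2 + iγ + w` lies in `Ω₁`. [cite: Zhang2022LandauSiegel, §4 Lemma 4.1, Lemma 4.6 (proof)] -/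
theorem half_add_mem_Omega1 (hℓ : 3 ≤ ell D) {γ : ℝ} (hγ : |γ - 2 * π * t0 D| < ell1 D + 2)
    {w : ℂ} (hw : ‖w‖ < 2 * alpha D) : (1 / 2 : ℂ) + γ * I + w ∈ Omega1 D := by
  have h2α := two_mul_alpha_le_of_three_le_ell hℓ
  have h100 := log_div_le hℓ
  have hre : |w.re| < 2 * alpha D := lt_of_le_of_lt (Complex.abs_re_le_norm w) hw
  have him : |w.im| < 2 * alpha D := lt_of_le_of_lt (Complex.abs_im_le_norm w) hw
  obtain ⟨hre1, hre2⟩ := abs_lt.mp hre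
  obtain ⟨him1, him2⟩ := abs_lt.mp him
  obtain ⟨hγ1, hγ2⟩ := abs_lt.mp hγ
  rw [Omega1, Lemma43.mem_Omega1_iff]
  have e1 : ((1 / 2 : ℂ) + γ * I + w).re = 1 / 2 + w.re := by simp
  have e2 : ((1 / 2 : ℂ) + γ * I + w).im = γ + w.im := by simp
  rw [e1, e2]
  refine ⟨by linarith, by linarith, ?_⟩
  rw [abs_lt]; constructor <;> linarith

/-- **"By Lemma 4.2, `𝒜(s,ψ)` is analytic … in `Ω₁`"** (§4 p. 21), in the form the Rouché step
needs: for `D` large (beyond Lemma 4.2's threshold, with `𝓛 ≥ 3` and `C₄₂𝓛⁻²²⁷ ≤ 1/2`), `ψ ∈ Ψ₁`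
and `|γ − 2πt₀| < 𝓛₁ + 2`, the function `w ↦ 𝒜(1/2+iγ+w,ψ) = L(s,ψ)L(s,ψχ)/F(s,ψ)` is holomorphic
on the disc `|w| < 2α` (there `s ∈ Ω₁`, so `|FG − 1| ≤ 1/2` and `F(s,ψ) ≠ 0`).
[cite: Zhang2022LandauSiegel, §4 p. 21] -/
theorem differentiableOn_calA_shift {C₂ : ℝ} (hD : 3 ≤ D) (hp : χ.IsPrimitive) (hℓ : 3 ≤ ell D)
    (hℓC : 2 * C₂ ≤ ell D) (x : Chr D)
    (h42 : ∀ s ∈ Omega1 D, ‖Fpoly χ x s * Gpoly χ x s - 1‖ ≤ C₂ * (ell D ^ 227)⁻¹)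
    {γ : ℝ} (hγ : |γ - 2 * π * t0 D| < ell1 D + 2) :
    DifferentiableOn ℂ (fun w : ℂ => calA χ x ((1 / 2 : ℂ) + γ * I + w))
      (Metric.ball 0 (2 * alpha D)) := by
  have hℓ0 : 0 < ell D := by linarith
  have hℓ1 : 1 ≤ ell D := by linarith
  have hhalf : C₂ * (ell D ^ 227)⁻¹ ≤ 1 / 2 := by
    have h227 : ell D ≤ ell D ^ 227 := by
      calc ell D = ell D ^ 1 := (pow_one _).symm
        _ ≤ ell D ^ 227 := pow_le_pow_right₀ hℓ1 (by norm_num)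
    rw [← div_eq_mul_inv, div_le_iff₀ (pow_pos hℓ0 _)]
    linarith
  have hF : ∀ w ∈ Metric.ball (0 : ℂ) (2 * alpha D),
      Fpoly χ x ((1 / 2 : ℂ) + γ * I + w) ≠ 0 := by
    intro w hw
    have hΩ := half_add_mem_Omega1 hℓ hγ (mem_ball_zero_iff.mp hw)
    exact (inv_norm_le_two_mul_of_norm_mul_sub_one_le ((h42 _ hΩ).trans hhalf)).1
  have hshift : Differentiable ℂ (fun w : ℂ => (1 / 2 : ℂ) + γ * I + w) :=
    (differentiable_const _).add differentiable_id
  have hcalA : (fun w : ℂ => calA χ x ((1 / 2 : ℂ) + γ * I + w)) =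
      fun w => LL χ x ((1 / 2 : ℂ) + γ * I + w) / Fpoly χ x ((1 / 2 : ℂ) + γ * I + w) := rfl
  rw [hcalA]
  have hLL : Differentiable ℂ (LL χ x) := Skeleton.differentiable_LL χ hD hp x
  exact ((hLL.comp hshift).differentiableOn).div
    (((Skeleton.differentiable_Fpoly χ x).comp hshift).differentiableOn) hF

/-! ## The comparison function `1 − P^{−2w}` -/

omit [NeZero D] in
/-- `1 − P^{−2w}` is entire. [cite: Zhang2022LandauSiegel, §4 Lemma 4.6 (proof)] -/
theorem differentiable_one_sub_Pm2w (D : ℕ) : Differentiable ℂ (fun w : ℂ => 1 - Pm2w D w) := by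
  have h : (fun w : ℂ => 1 - Pm2w D w) = fun w => 1 - Lemma46.Pw (bigP D) w := by
    funext w; rw [Pm2w_eq_Pw]
  rw [h]
  exact fun w => (Lemma46.hasDerivAt_one_sub_Pw (bigP D) w).differentiableAt

omit [NeZero D] in
/-- `d/dw (1 − P^{−2w})|_{w=0} = 2 log P ≠ 0` (`P > 1` for `D ≥ 2`): the zero of the comparison
function at `w = 0` is simple. [cite: Zhang2022LandauSiegel, §4 Lemma 4.6 (proof)] -/
theorem deriv_one_sub_Pm2w_zero_ne_zero (hD : 2 ≤ D) :
    deriv (fun w : ℂ => 1 - Pm2w D w) 0 ≠ 0 := by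
  have h : (fun w : ℂ => 1 - Pm2w D w) = fun w => 1 - Lemma46.Pw (bigP D) w := by
    funext w; rw [Pm2w_eq_Pw]
  rw [h]
  have hP : 1 < bigP D := by
    rw [bigP]
    exact Real.one_lt_exp_iff.mpr (pow_pos (Real.log_pos (by exact_mod_cast hD)) 9)
  exact Lemma46.deriv_one_sub_Pw_ne_zero hP 0

/-! ## The edge: Lemma 4.6's Rouché step modulo FACT F-29 -/

/-- **Lemma 4.6, the Rouché step** (`Z22:Lem4.6.pf`, §4 p. 22: "the function `𝒜(1/2+iγ+w,ψ)` has
exactly one zero inside the circle `|w| = α(1−c′α𝓛)`, counted with multiplicity. By the Rouché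
theorem, this can be reduced to proving that `|𝒜(1/2+iγ+w,ψ) − (1−P^{−2w})| < |1−P^{−2w}|` for
`|w| = α(1−c′α𝓛)`, since the function `1 − P^{−2w}` has exactly one zero inside this circle which
is at `w = 0`") — kernel-checked MODULO the exact-count Rouché theorem:
`hRouche` **-- FACT F-29 (hypothesis form)** [Conway 1973, V §3 Thm 3.8] is the statement "`f, g`
holomorphic on a neighbourhood of `B̄(c,r)`, `|f − g| < |g|` on `|z − c| = r` ⇒ equal numbers of
zeros in `B(c,r)` counted with multiplicity (`∑ᶠ analyticOrderNatAt`)". Given it, Lemma 4.2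
(`F ≠ 0` near the line, so `𝒜 = L·L/F` is holomorphic on `|w| < 2α ⊃ B̄(0, α(1−c′α𝓛))`), `c′ ≥ 0`
(so the radius is `≤ α`; it is `> 0` for `D` large) and the displayed inequality `Z22:§4.u048`, the
count for `𝒜(1/2+iγ+·,ψ)` equals that of `1 − P^{−2w}`, which is `1` (zero set `{0}` by
`OneSubPwOneZero`, simple since `2log P ≠ 0`); a count of `1` is one simple zero
(`existsUnique_zero_of_finsum_analyticOrderNatAt_eq_one`) — the node `Lem46OneZero c′`.
[cite: Zhang2022LandauSiegel, §4 Lemma 4.6 (proof)] -/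
theorem lem46OneZero_of_rouche {c' : ℝ}
    -- FACT F-29 (hypothesis form): Rouché's theorem, exact-count form [Conway 1973, V.3.8]
    (hRouche : ∀ (f g : ℂ → ℂ) (c : ℂ) (r : ℝ), 0 < r →
      (∃ U : Set ℂ, IsOpen U ∧ Metric.closedBall c r ⊆ U ∧ DifferentiableOn ℂ f U ∧
        DifferentiableOn ℂ g U) →
      (∀ z ∈ Metric.sphere c r, ‖f z - g z‖ < ‖g z‖) →
      ∑ᶠ z ∈ Metric.ball c r, analyticOrderNatAt f z =
        ∑ᶠ z ∈ Metric.ball c r, analyticOrderNatAt g z)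
    (h42 : Lemma42) (hc : 0 ≤ c') (h48 : Step4u048 c') : Lem46OneZero c' := by
  obtain ⟨C₂, h42⟩ := h42
  obtain ⟨D₁, hD₁, hδ⟩ := exists_delta_le c' (1 / 2) (by norm_num)
  have hone : OneSubPwOneZero c' := oneSubPwOneZero_of_nonneg hc
  obtain ⟨D₀, hD₀⟩ := (h42.and h48).and hone
  refine ⟨max (max D₀ D₁) (max 3 ⌈Real.exp (max 3 (2 * C₂))⌉₊), fun D _ χ hD hq hp x hx ρ hρ hAρ => ?_⟩
  have hDD₀ : D₀ ≤ D := le_trans (le_trans (le_max_left _ _) (le_max_left _ _)) hD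
  have hDD₁ : D₁ ≤ D := le_trans (le_trans (le_max_right _ _) (le_max_left _ _)) hD
  have hD3 : 3 ≤ D := le_trans (le_trans (le_max_left _ _) (le_max_right _ _)) hD
  have hDe : ⌈Real.exp (max 3 (2 * C₂))⌉₊ ≤ D :=
    le_trans (le_trans (le_max_right _ _) (le_max_right _ _)) hD
  obtain ⟨hℓ3, hℓC⟩ := max_le_iff.mp (le_ell_of_ceil_exp_le hDe)
  have hD2 : 2 ≤ D := by omega
  obtain ⟨⟨e42, e48⟩, eone⟩ := hD₀ D χ hDD₀ hq hp
  -- the radius `r = α(1 − c′α𝓛)`, `α/2 ≤ r ≤ α`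
  have hα : 0 < alpha D := by
    rw [Section2.alpha_eq_pi_div_ell9]; exact div_pos Real.pi_pos (pow_pos (by linarith) 9)
  have hδle : c' * alpha D * ell D ≤ 1 / 2 := hδ D hDD₁
  have hδ0 : 0 ≤ c' * alpha D * ell D := by
    rw [mul_assoc]; exact mul_nonneg hc (alpha_mul_ell_nonneg D)
  set r : ℝ := alpha D * (1 - c' * alpha D * ell D) with hr
  have hr0 : 0 < r := by rw [hr]; exact mul_pos hα (by linarith)
  have hr2α : r < 2 * alpha D := by
    have h1 : alpha D * (1 - c' * alpha D * ell D) ≤ alpha D * 1 := by gcongr; linarith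
    rw [hr]; linarith
  have hγ : |ρ.im - 2 * π * t0 D| < ell1 D + 2 := hρ.2.2
  set f : ℂ → ℂ := fun w => calA χ x ((1 / 2 : ℂ) + ρ.im * I + w) with hf
  set g : ℂ → ℂ := fun w => 1 - Pm2w D w with hg
  have hfU : DifferentiableOn ℂ f (Metric.ball 0 (2 * alpha D)) :=
    differentiableOn_calA_shift χ hD3 hp hℓ3 hℓC x (e42 x hx) hγ
  have hgU : DifferentiableOn ℂ g (Metric.ball 0 (2 * alpha D)) :=
    (differentiable_one_sub_Pm2w D).differentiableOn
  -- Rouché: equal counts in `|w| < r`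
  have hcount := hRouche f g 0 r hr0
    ⟨Metric.ball 0 (2 * alpha D), Metric.isOpen_ball, Metric.closedBall_subset_ball hr2α, hfU, hgU⟩
    (fun z hz => e48 x hx ρ hρ hAρ z (by rwa [mem_sphere_zero_iff_norm] at hz))
  -- the count of `1 − P^{−2w}` is `1`
  have hg_an : AnalyticOnNhd ℂ g (Metric.ball 0 r) :=
    ((differentiable_one_sub_Pm2w D).differentiableOn.analyticOnNhd Metric.isOpen_ball)
  have hgcount : ∑ᶠ w ∈ Metric.ball (0 : ℂ) r, analyticOrderNatAt g w = 1 :=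
    finsum_analyticOrderNatAt_eq_one_of_zeros_eq hg_an (eone) (deriv_one_sub_Pm2w_zero_ne_zero hD2)
  rw [hgcount] at hcount
  -- hence `f` has exactly one zero in the disc, and it is simple
  have hf_an : AnalyticOnNhd ℂ f (Metric.ball 0 r) :=
    (hfU.mono (Metric.ball_subset_ball hr2α.le)).analyticOnNhd Metric.isOpen_ball
  obtain ⟨w₀, hset, hder⟩ := existsUnique_zero_of_finsum_analyticOrderNatAt_eq_one hf_an hcount
  refine ⟨w₀, hset, ?_⟩
  -- `f′(w₀) = 𝒜′(1/2 + iγ + w₀)`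
  have hcomp : deriv f w₀ = deriv (calA χ x) ((1 / 2 : ℂ) + ρ.im * I + w₀) := by
    rw [hf]
    exact deriv_comp_const_add (calA χ x) ((1 / 2 : ℂ) + ρ.im * I) w₀
  rwa [hcomp] at hder

/-- **Lemma 4.6 modulo FACT F-29** — the whole of `Z22:Lem4.6.pf` composed: (4.12) ⇒ the Rouché
hypothesis `Z22:§4.u048` for `c′ > max(C/6, 0)` (`step4u048_of_eq412`, slice L1-t7) ⇒ exactly one
simple zero in `|w| < α(1−c′α𝓛)` (`lem46OneZero_of_rouche`, FACT F-29 as hypothesis) ⇒ Lemma 4.6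
by the reflection `s ↦ 1 − s̄` and "`𝒜` has the same zeros as `L(s,ψ)L(s,ψχ)`" (`dedLem46_holds`,
`llZeroReflect_holds`, slice L1-t7). Hence: **`RouchéCount → Lemma42 → Eq412 → Lemma46 c′` for every
sufficiently large `c′`** ("`c′` is a sufficiently [large] constant", p. 22).
[cite: Zhang2022LandauSiegel, §4 Lemma 4.6] -/
theorem lemma46_of_rouche
    -- FACT F-29 (hypothesis form): Rouché's theorem, exact-count form [Conway 1973, V.3.8]
    (hRouche : ∀ (f g : ℂ → ℂ) (c : ℂ) (r : ℝ), 0 < r →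
      (∃ U : Set ℂ, IsOpen U ∧ Metric.closedBall c r ⊆ U ∧ DifferentiableOn ℂ f U ∧
        DifferentiableOn ℂ g U) →
      (∀ z ∈ Metric.sphere c r, ‖f z - g z‖ < ‖g z‖) →
      ∑ᶠ z ∈ Metric.ball c r, analyticOrderNatAt f z =
        ∑ᶠ z ∈ Metric.ball c r, analyticOrderNatAt g z)
    (h42 : Lemma42) (h412 : Eq412) : ∃ c₀ : ℝ, ∀ c' : ℝ, c₀ < c' → Lemma46 c' := by
  obtain ⟨c₀, h48⟩ := step4u048_of_eq412 h412
  refine ⟨max c₀ 0, fun c' hc' => ?_⟩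
  have hc0 : c₀ < c' := lt_of_le_of_lt (le_max_left _ _) hc'
  have hc : 0 ≤ c' := (lt_of_le_of_lt (le_max_right _ _) hc').le
  exact dedLem46_holds c' h42 llZeroReflect_holds (lem46OneZero_of_rouche hRouche h42 hc (h48 c' hc0))

end Literature.NumberTheory.LFunctions.Zhang2022.Section4
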